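import Literature.AlgebraicGeometry.Frobenioids.ArchimedeanDivisors
import HarnessLib

/-!
# Frobenioids II, Example 3.3 (i): `Div(φ) = log λ` for the LARGEST `λ` — PROOF

Mochizuki, *The geometry of Frobenioids II: poly-Frobenioids*, Kyushu J. Math. **62** (2008)
401–460, §3, Example 3.3 (i), author's text p. 28 [cite: MochizukiFrdII2008, Ex 3.3 (i) p.28]:
"we shall write `Div(φ) := log(λ) ∈ ℝ_{≥0}`, for the largest `λ ∈ ℝ_{>0}` such that
`λ · Im(A_L^{⊗d}) ⊆ A_K|_L`."

`ArchimedeanDivisors.lean` DEFINES `Div(φ)` by the closed formula `log( tip(A_K) / (|c| · tip(A_L)^d) )`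
(`C0.ratio`) and records the printed description as the named statement `C0.DivIsLogLargest`. This file
DISCHARGES it: `ratio φ` is the greatest positive real `λ` with `λ · Im(A_L^{⊗d}) ⊆ A_K|_L`
(positive real scalings change neither the angular part of an element nor the Galois twist, and an
element of `A_L^{⊗d}` has absolute value at most `tip(A_L)^d`, with equality attained at products of
boundary points).
-/

namespace Literature.AlgebraicGeometry.Frobenioids

open CategoryTheory Opposite
open scoped Pointwise NNReal

noncomputable section

namespace ArchFrd

/-! ### Positive real scalings inside `ℂ^×` -/

/-- `|t · u| = t · |u|` for a positive real `t`. [cite: MochizukiFrdII2008, Def 3.1 (ii) p.23] -/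
theorem absHom_ofPosReal_mul (t : PosReal) (u : ℂˣ) :
    absHom ℂ (ofPosReal ℂ t * u) = t * absHom ℂ u := by
  rw [map_mul, absHom_ofPosReal]

/-- A positive real scaling does not change the angular part: `(t·u)/|t·u| = u/|u|` (via the canonical
decomposition `O_K^× × ord(K^×) ≃ K^×`, Def. 3.1 (ii)). [cite: MochizukiFrdII2008, Def 3.1 (ii) p.24] -/
theorem unitPart_ofPosReal_mul (t : PosReal) (u : ℂˣ) :
    unitPart ℂ (ofPosReal ℂ t * u) = unitPart ℂ u := by
  have h1 : unitDecomposition ℂ (unitPart ℂ (ofPosReal ℂ t * u), absHom ℂ (ofPosReal ℂ t * u)) =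
      ofPosReal ℂ t * u := (unitDecomposition ℂ).apply_symm_apply _
  have h2 : unitDecomposition ℂ (unitPart ℂ u, t * absHom ℂ u) = ofPosReal ℂ t * u := by
    have h := (unitDecomposition ℂ).apply_symm_apply u
    change ((unitPart ℂ u : ℂˣ)) * ofPosReal ℂ (absHom ℂ u) = u at h
    change ((unitPart ℂ u : ℂˣ)) * ofPosReal ℂ (t * absHom ℂ u) = ofPosReal ℂ t * u
    rw [map_mul, mul_left_comm, h]
  have h3 := (unitDecomposition ℂ).injective (h1.trans h2.symm)
  rw [absHom_ofPosReal_mul] at h3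
  exact (Prod.ext_iff.mp h3).1

/-- Membership in an angular region is preserved by scaling DOWN the absolute value with the same
angular part: if `k ∈ A` and `|k′| ≤ tip`, `unitPart k′ = unitPart k`, then `k′ ∈ A`.
[cite: MochizukiFrdII2008, Def 3.1 (iii) p.24] -/
theorem AngularRegion.mem_carrier_iff (A : AngularRegion ℂ) (u : ℂˣ) :
    u ∈ A.carrier ↔ unitPart ℂ u ∈ A.dir ∧ absHom ℂ u ≤ A.tip := Iff.rfl

/-- An element of the pointwise power `A^{⊗n}` has absolute value at most `tip(A)^n`.
[cite: MochizukiFrdII2008, Ex 3.3 (i) p.28] -/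
theorem norm_le_of_mem_carrier_pow (A : AngularRegion ℂ) :
    ∀ (n : ℕ) (a : ℂˣ), a ∈ A.carrier ^ n → ‖(a : ℂ)‖ ≤ (A.tip : ℝ) ^ n
  | 0, a, ha => by
    rw [pow_zero, Set.mem_one] at ha
    rw [ha, pow_zero, Units.val_one, norm_one]
  | n + 1, a, ha => by
    rw [pow_succ, Set.mem_mul] at ha
    obtain ⟨x, hx, y, hy, rfl⟩ := ha
    rw [Units.val_mul, norm_mul, pow_succ]
    have hy' : ‖(y : ℂ)‖ ≤ A.tip := by
      have := hy.2
      rw [← Subtype.coe_le_coe, coe_absHom] at this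
      exact this
    exact mul_le_mul (norm_le_of_mem_carrier_pow A n x hx) hy' (norm_nonneg _)
      (pow_nonneg A.tip.2.le _)

namespace C0

variable {X Y : C0}

/-- If `x ∈ Im(A_L^{⊗d}) = c · A_L^{⊗d}` then `|x| ≤ |c| · tip(A_L)^d`.
[cite: MochizukiFrdII2008, Ex 3.3 (i) p.28] -/
theorem norm_le_of_mem_image (φ : X ⟶ Y) {x : ℂˣ} (hx : x ∈ Hom.image φ) :
    ‖(x : ℂ)‖ ≤ ‖(scalar φ : ℂ)‖ * X.tip ^ (degFr φ : ℕ) := by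
  obtain ⟨a, ha, rfl⟩ := hx
  change ‖((scalar φ * a : ℂˣ) : ℂ)‖ ≤ _
  rw [Units.val_mul, norm_mul]
  exact mul_le_mul_of_nonneg_left (norm_le_of_mem_carrier_pow X.region _ a ha) (norm_nonneg _)

/-- `ratio(φ) · Im(A_L^{⊗d}) ⊆ A_K|_L`: the scaling by `ratio φ = tip_K/(|c|·tip_L^d)` still lands in
`A_K|_L` (same angular parts, absolute values at most `tip_K`). [cite: MochizukiFrdII2008, Ex 3.3 (i) p.28] -/
theorem ratio_smul_image_subset (φ : X ⟶ Y) :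
    ofPosReal ℂ ⟨ratio φ, ratio_pos φ⟩ • Hom.image φ ⊆ pullRegion Y (Base φ) := by
  rintro _ ⟨x, hx, rfl⟩
  obtain ⟨k, hk, hkx⟩ := φ.mapsTo hx
  have hxn := norm_le_of_mem_image φ hx
  refine ⟨ofPosReal ℂ ⟨ratio φ, ratio_pos φ⟩ * k, ?_, ?_⟩
  · -- membership in `A_K`: same angular part as `k`, absolute value `ratio · |x| ≤ tip_K`
    rw [AngularRegion.mem_carrier_iff, unitPart_ofPosReal_mul, absHom_ofPosReal_mul]
    refine ⟨hk.1, ?_⟩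
    rw [← Subtype.coe_le_coe, Positive.val_mul, coe_absHom]
    change ratio φ * ‖(k : ℂ)‖ ≤ Y.tip
    have hkn : ‖(k : ℂ)‖ = ‖(x : ℂ)‖ := by
      rw [← D0.norm_galAct (D0.Hom.twists (Base φ)) k]
      exact congrArg (fun u : ℂˣ => ‖(u : ℂ)‖) hkx
    rw [hkn]
    have hpos : 0 < ‖(scalar φ : ℂ)‖ * X.tip ^ (degFr φ : ℕ) :=
      mul_pos (norm_pos_iff.mpr (scalar φ).ne_zero) (pow_pos X.tip_pos _)
    calc ratio φ * ‖(x : ℂ)‖ ≤ ratio φ * (‖(scalar φ : ℂ)‖ * X.tip ^ (degFr φ : ℕ)) :=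
          mul_le_mul_of_nonneg_left hxn (ratio_pos φ).le
      _ = Y.tip := div_mul_cancel₀ _ hpos.ne'
  · -- the twist commutes with real scalings
    change D0.galAct _ (ofPosReal ℂ ⟨ratio φ, ratio_pos φ⟩ * k) = ofPosReal ℂ ⟨ratio φ, ratio_pos φ⟩ • x
    rw [map_mul, D0.galAct_eq_self_of_mem_scalars_real _ (ofPosReal_mem_scalars _ _), smul_eq_mul]
    exact congrArg _ hkx

/-- Any admissible scaling is at most `ratio φ` (test at the `d`-th power of a boundary point).
[cite: MochizukiFrdII2008, Ex 3.3 (i) p.28] -/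
theorem le_ratio_of_smul_image_subset (φ : X ⟶ Y) {t : ℝ} (ht : 0 < t)
    (h : ofPosReal ℂ ⟨t, ht⟩ • Hom.image φ ⊆ pullRegion Y (Base φ)) : t ≤ ratio φ := by
  obtain ⟨a, ha, habs⟩ := exists_mem_boundary X.region
  have hmem : ofPosReal ℂ ⟨t, ht⟩ • (scalar φ • a ^ (degFr φ : ℕ)) ∈ pullRegion Y (Base φ) :=
    h (Set.smul_mem_smul_set (Set.smul_mem_smul_set (Set.pow_mem_pow ha)))
  obtain ⟨y, hy, hyeq⟩ := hmem
  have hyle : (absHom ℂ y : ℝ) ≤ Y.tip := hy.2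
  have ha' : ‖(a : ℂ)‖ = X.tip := by rw [← coe_absHom, habs]; rfl
  have hnorm : t * (‖(scalar φ : ℂ)‖ * X.tip ^ (degFr φ : ℕ)) ≤ Y.tip := by
    calc t * (‖(scalar φ : ℂ)‖ * X.tip ^ (degFr φ : ℕ))
        = ‖((ofPosReal ℂ ⟨t, ht⟩ • (scalar φ • a ^ (degFr φ : ℕ)) : ℂˣ) : ℂ)‖ := by
          rw [smul_eq_mul, smul_eq_mul, Units.val_mul, Units.val_mul, norm_mul, norm_mul,
            Units.val_pow_eq_pow_val, norm_pow, ha', coe_ofPosReal, RCLike.norm_ofReal, abs_of_pos ht]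
      _ = ‖(((Base φ).act y : ℂˣ) : ℂ)‖ := by rw [hyeq]
      _ = (absHom ℂ y : ℝ) := by rw [coe_absHom]; exact D0.norm_galAct _ _
      _ ≤ Y.tip := hyle
  have hpos : 0 < ‖(scalar φ : ℂ)‖ * X.tip ^ (degFr φ : ℕ) :=
    mul_pos (norm_pos_iff.mpr (scalar φ).ne_zero) (pow_pos X.tip_pos _)
  exact (le_div_iff₀ hpos).mpr hnorm

/-- **Example 3.3 (i)**: `Div(φ) = log(λ)` for the LARGEST `λ ∈ ℝ_{>0}` with
`λ · Im(A_L^{⊗d}) ⊆ A_K|_L` — DISCHARGES `C0.DivIsLogLargest`. [cite: MochizukiFrdII2008, Ex 3.3 (i) p.28] -/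
theorem divIsLogLargest_holds : DivIsLogLargest := by
  intro X Y φ
  refine ⟨⟨ratio_pos φ, fun _ => ratio_smul_image_subset φ⟩, fun t ht => ?_⟩
  exact le_ratio_of_smul_image_subset φ ht.1 (ht.2 ht.1)

end C0

end ArchFrd

end

end Literature.AlgebraicGeometry.Frobenioids
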